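import Mathlib.Tactic.NormNum
import Mathlib.Tactic.Linarith
import Mathlib.Order.Lattice
import Mathlib.Data.Rat.Cast.Order
import HarnessLib

/-!
# Box-level two-sided windows assembled from per-cell windows: the OUTWARD (hull) pair is sound, it is
# the tightest pair the cell data license, and «keep the tighter» across cells is unsound

Venture CertifiedManyBodySolver, cell `pub/hubbard-downfold`, seat hubbard-downfold-score-1 (second scoring engine);
namespace `Summit.Ventures.CertifiedManyBodySolver.Downfold.CellScore`. Context: run #5 (maps run-2026-08-26e) carries on
M14/M15/M16/M17 one certified annex each, «two-sided ground-state energy window on the WHOLE object-E router box, PIECEWISE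
over four U-cells (kernel-checked cover) … hull pair on the whole box [lo, hi]» (hubbard-box-p2 hand-ins; kernel theorems
`la214E_M1x_piecewise_word` + `_cert_check`, Certificates/HubbardSquare_boxword_La214E_M1x_kdcover.lean), spelled kind
`other` + `window_t` under schema v1.5 pending deputy-2's Q16 ruling on a typed kind. Whatever the spelling, a scorer
receives PAIRS: per-cell pairs `[lo_j, hi_j]` and one box-level pair `[lo, hi]`, and can check mechanically only how they
relate. Everything here is PROVED (order reasoning over any linear order `β` ⊇ the energies; ℚ numerals for the record).

WHAT THIS IS NOT: not an energy bound, not a cover certificate (those are box-p2's kernel theorems and kd-certificates,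
`Downfold.S2SeamCover`), not a rule of the acceptance test. It is the KERNEL REFERENCE for the bookkeeping sentence
«the box-level pair is the HULL of the cell pairs, printed outward»:

* §1 `Win β` = a pair; `wf` (lo ≤ hi); `holds w e`; `contains W w` (= the OUTWARD check: `W.lo ≤ w.lo ∧ w.hi ≤ W.hi`);
  `hull`, `hullAll` (the componentwise min/max of a nonempty family); `width`.
* §2 OUTWARD ALGEBRA: `holds_of_contains` (a wider pair says less and stays true), `hull_contains_left/right`,
  `hullAll_contains_head/of_mem`, and `contains_hullAll_iff`: a pair contains the hull iff it contains every cell pair —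
  the hull is the LEAST outward pair.
* §3 SOUNDNESS `holds_on_box_of_outward_of_cover`: over any parameter type `Θ`, box `box`, cells `mem j`, energy `E`,
  if every box point lies in some cell whose pair holds there (the piecewise word) and the printed pair contains every
  cell pair, the printed pair holds at every box point. No topology, no cover certificate is re-proved: the piecewise
  word is the HYPOTHESIS, exactly as the kernel files of record conclude it.
* §4 MINIMALITY `contains_of_sound`: conversely, if a printed pair is sound for EVERY energy function compatible with the
  cell pairs, every cell pair is well-formed and every cell meets the box, then the printed pair contains every cell pair
  (hence the hull, §2) — the cell data alone license nothing tighter than the hull.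
* §5 THE MISTAKE TO AVOID `tighter_pair_unsound`: two cells, pairs [−1, −1/2] and [−9/10, −2/5]; the «tighter» pair
  [−9/10, −1/2] (intersection) FAILS at a point of cell 1 with energy −1, although both cell words hold. Contrast
  `holds_inter_of_holds`: two pairs that hold for the SAME value may be intersected — C5 «keep the tighter» is a rule
  about two statements on one set, never about two cells.
* §6 numbers of record: M15's four cell pairs (A [−0.9561961717, −0.5228507720], B [−0.9308975186, −0.4331426257],
  C [−0.9308975186, −0.3097066715], D [−0.9308975186, −0.2384112109] t_eff) hull to exactly the printed box pair
  [−0.9561961717, −0.2384112109]; each cell pair is contained in it; its width 0.7177849608 t_eff; the printed M14/M16/M17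
  box pairs are well-formed.
-/

namespace Summit.Ventures.CertifiedManyBodySolver.Downfold

namespace CellScore

/-! ## §1 Pairs and the outward check -/

/-- A two-sided window `[lo, hi]` with end points in a linear order `β` (ℚ as printed; ℝ for the kernel energies).
[folklore] -/
structure Win (β : Type*) where
  /-- floor -/
  lo : β
  /-- ceiling -/
  hi : β
  deriving DecidableEq, Repr

namespace Win

variable {β : Type*} [LinearOrder β]

/-- well-formed: floor ≤ ceiling. [folklore] -/
def wf (w : Win β) : Bool := decide (w.lo ≤ w.hi)

/-- the window holds for the value `e`: `lo ≤ e ≤ hi`. [folklore] -/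
def holds (w : Win β) (e : β) : Bool := decide (w.lo ≤ e ∧ e ≤ w.hi)

/-- THE OUTWARD CHECK: `W` contains `w` (`W.lo ≤ w.lo` and `w.hi ≤ W.hi`) — what a scorer can verify between a printed
box-level pair `W` and a typed cell pair `w`. [folklore] -/
def contains (W w : Win β) : Bool := decide (W.lo ≤ w.lo ∧ w.hi ≤ W.hi)

/-- hull of two pairs: componentwise min / max. [folklore] -/
def hull (v w : Win β) : Win β := ⟨min v.lo w.lo, max v.hi w.hi⟩

/-- hull of a NONEMPTY family given as head + tail. [folklore] -/
def hullAll (w : Win β) : List (Win β) → Win β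
  | [] => w
  | v :: vs => hull w (hullAll v vs)

/-- width `hi − lo` (for the informativeness print; needs subtraction, so stated over ℚ). [folklore] -/
def width (w : Win ℚ) : ℚ := w.hi - w.lo

/-- `holds` unfolded. [folklore] -/
theorem holds_iff (w : Win β) (e : β) : w.holds e = true ↔ w.lo ≤ e ∧ e ≤ w.hi := by
  simp [holds]

/-- `contains` unfolded. [folklore] -/
theorem contains_iff (W w : Win β) : W.contains w = true ↔ W.lo ≤ w.lo ∧ w.hi ≤ W.hi := by
  simp [contains]

/-- `wf` unfolded. [folklore] -/
theorem wf_iff (w : Win β) : w.wf = true ↔ w.lo ≤ w.hi := by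
  simp [wf]

/-! ## §2 Outward algebra: a wider pair says less; the hull is the least outward pair -/

/-- WIDENING SAYS LESS AND STAYS TRUE: if `W` contains `w` and `w` holds for `e`, so does `W`. [folklore] -/
theorem holds_of_contains (W w : Win β) (e : β) (hc : W.contains w = true) (h : w.holds e = true) :
    W.holds e = true := by
  rw [contains_iff] at hc
  rw [holds_iff] at h ⊢
  exact ⟨le_trans hc.1 h.1, le_trans h.2 hc.2⟩

/-- `contains` is reflexive. [folklore] -/
theorem contains_refl (w : Win β) : w.contains w = true := by
  rw [contains_iff]; exact ⟨le_rfl, le_rfl⟩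

/-- `contains` is transitive. [folklore] -/
theorem contains_trans (U V w : Win β) (h₁ : U.contains V = true) (h₂ : V.contains w = true) :
    U.contains w = true := by
  rw [contains_iff] at h₁ h₂ ⊢
  exact ⟨le_trans h₁.1 h₂.1, le_trans h₂.2 h₁.2⟩

/-- A pair that holds for some value is well-formed. [folklore] -/
theorem wf_of_holds (w : Win β) (e : β) (h : w.holds e = true) : w.wf = true := by
  rw [holds_iff] at h; rw [wf_iff]; exact le_trans h.1 h.2

/-- The hull contains its left argument. [folklore] -/
theorem hull_contains_left (v w : Win β) : (hull v w).contains v = true := by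
  rw [contains_iff]; exact ⟨min_le_left _ _, le_max_left _ _⟩

/-- The hull contains its right argument. [folklore] -/
theorem hull_contains_right (v w : Win β) : (hull v w).contains w = true := by
  rw [contains_iff]; exact ⟨min_le_right _ _, le_max_right _ _⟩

/-- A pair contains a hull iff it contains both parts. [folklore] -/
theorem contains_hull_iff (W v w : Win β) :
    W.contains (hull v w) = true ↔ W.contains v = true ∧ W.contains w = true := by
  simp only [contains_iff, hull, le_min_iff, max_le_iff]
  tauto

/-- `hullAll` contains its head. [folklore] -/
theorem hullAll_contains_head (w : Win β) (ws : List (Win β)) : (hullAll w ws).contains w = true := by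
  cases ws with
  | nil => exact contains_refl w
  | cons v vs => exact hull_contains_left w (hullAll v vs)

/-- `hullAll` contains every member of its tail. [folklore] -/
theorem hullAll_contains_of_mem (w : Win β) (ws : List (Win β)) (u : Win β) (hu : u ∈ ws) :
    (hullAll w ws).contains u = true := by
  induction ws generalizing w with
  | nil => simp at hu
  | cons v vs ih =>
    simp only [hullAll]
    rcases List.mem_cons.mp hu with rfl | hvs
    · exact contains_trans _ _ _ (hull_contains_right w (hullAll u vs)) (hullAll_contains_head u vs)
    · exact contains_trans _ _ _ (hull_contains_right w (hullAll v vs)) (ih v hvs)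

/-- THE HULL IS THE LEAST OUTWARD PAIR: `W` contains `hullAll w ws` iff `W` contains `w` and every member of `ws`.
[folklore] -/
theorem contains_hullAll_iff (W w : Win β) (ws : List (Win β)) :
    W.contains (hullAll w ws) = true ↔ W.contains w = true ∧ ∀ u ∈ ws, W.contains u = true := by
  induction ws generalizing w with
  | nil => simp [hullAll]
  | cons v vs ih =>
    simp only [hullAll, contains_hull_iff, ih v, List.forall_mem_cons]

/-! ## §3 Soundness of an outward pair given the piecewise word -/

section cover

variable {Θ : Type*} {ι : Type*}

/-- SOUNDNESS. Parameter points `Θ`, the router box `box`, cells `mem j`, their certified pairs `win j`, an energy `E`.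
Hypotheses: the PIECEWISE WORD of record (every box point lies in some cell whose pair holds there) and the OUTWARD check
(the printed pair `W` contains every cell pair). Conclusion: `W` holds at every box point. [folklore] -/
theorem holds_on_box_of_outward_of_cover (box : Θ → Prop) (mem : ι → Θ → Prop) (win : ι → Win β) (E : Θ → β)
    (W : Win β)
    (hcover : ∀ θ, box θ → ∃ j, mem j θ ∧ (win j).holds (E θ) = true)
    (hout : ∀ j, W.contains (win j) = true) :
    ∀ θ, box θ → W.holds (E θ) = true := by
  intro θ hθ
  obtain ⟨j, _, hj⟩ := hcover θ hθ
  exact holds_of_contains W (win j) (E θ) (hout j) hj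

/-- The same with the cells given as a nonempty LIST of (membership, pair) and the printed pair = their `hullAll` — the
outward check then holds by construction (§2), so the piecewise word alone gives the hull on the box. [folklore] -/
theorem hullAll_holds_on_box_of_cover (box : Θ → Prop) (E : Θ → β) (c : (Θ → Prop) × Win β)
    (cs : List ((Θ → Prop) × Win β))
    (hcover : ∀ θ, box θ → ∃ d ∈ c :: cs, d.1 θ ∧ d.2.holds (E θ) = true) :
    ∀ θ, box θ → (hullAll c.2 (cs.map Prod.snd)).holds (E θ) = true := by
  intro θ hθ
  obtain ⟨d, hd, _, hholds⟩ := hcover θ hθ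
  refine holds_of_contains _ d.2 (E θ) ?_ hholds
  rcases List.mem_cons.mp hd with rfl | hds
  · exact hullAll_contains_head _ _
  · exact hullAll_contains_of_mem _ _ d.2 (List.mem_map.mpr ⟨d, hds, rfl⟩)

/-! ## §4 Minimality: the cell pairs license nothing tighter than the hull -/

/-- MINIMALITY. If a printed pair `W` is SOUND FOR EVERY energy function compatible with the cell pairs (i.e. for every
`E` satisfying the piecewise word, `W` holds on the box), every cell pair is well-formed, every cell MEETS the box, and
the cells cover the box, then `W` contains every cell pair — so by `contains_hullAll_iff` it contains the hull: no pair
tighter than the hull follows from the cell data alone. (Proof: for cell `j` pick a box point `θ₀ ∈ cell j` and the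
compatible energy that equals `lo j` at `θ₀` — resp. `hi j` — and a cell floor elsewhere.) [folklore] -/
theorem contains_of_sound (box : Θ → Prop) (mem : ι → Θ → Prop) (win : ι → Win β) (W : Win β)
    (hsound : ∀ E : Θ → β, (∀ θ, box θ → ∃ j, mem j θ ∧ (win j).holds (E θ) = true) →
      ∀ θ, box θ → W.holds (E θ) = true)
    (hwf : ∀ j, (win j).wf = true) (hmeet : ∀ j, ∃ θ, box θ ∧ mem j θ)
    (hcov : ∀ θ, box θ → ∃ j, mem j θ) :
    ∀ j, W.contains (win j) = true := by
  classical
  intro j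
  obtain ⟨θ₀, hθ₀, hmem₀⟩ := hmeet j
  -- a cell index for every point (any index off the box; `j` will do as the default)
  let pick : Θ → ι := fun θ => if h : box θ then Classical.choose (hcov θ h) else j
  have pick_mem : ∀ θ, box θ → mem (pick θ) θ := by
    intro θ h
    simp only [pick, dif_pos h]
    exact Classical.choose_spec (hcov θ h)
  have floor_holds : ∀ i, (win i).holds (win i).lo = true := by
    intro i; rw [holds_iff]; exact ⟨le_rfl, (wf_iff _).mp (hwf i)⟩
  have ceil_holds : ∀ i, (win i).holds (win i).hi = true := by
    intro i; rw [holds_iff]; exact ⟨(wf_iff _).mp (hwf i), le_rfl⟩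
  -- energy 1: the floor of cell j at θ₀, the floor of the picked cell elsewhere
  let E₁ : Θ → β := fun θ => if θ = θ₀ then (win j).lo else (win (pick θ)).lo
  have hE₁ : ∀ θ, box θ → ∃ i, mem i θ ∧ (win i).holds (E₁ θ) = true := by
    intro θ h
    by_cases hθ : θ = θ₀
    · subst hθ; exact ⟨j, hmem₀, by simp only [E₁, if_pos rfl]; exact floor_holds j⟩
    · exact ⟨pick θ, pick_mem θ h, by simp only [E₁, if_neg hθ]; exact floor_holds (pick θ)⟩
  have h₁ := hsound E₁ hE₁ θ₀ hθ₀
  simp only [E₁, if_pos rfl, holds_iff] at h₁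
  -- energy 2: the ceiling of cell j at θ₀
  let E₂ : Θ → β := fun θ => if θ = θ₀ then (win j).hi else (win (pick θ)).lo
  have hE₂ : ∀ θ, box θ → ∃ i, mem i θ ∧ (win i).holds (E₂ θ) = true := by
    intro θ h
    by_cases hθ : θ = θ₀
    · subst hθ; exact ⟨j, hmem₀, by simp only [E₂, if_pos rfl]; exact ceil_holds j⟩
    · exact ⟨pick θ, pick_mem θ h, by simp only [E₂, if_neg hθ]; exact floor_holds (pick θ)⟩
  have h₂ := hsound E₂ hE₂ θ₀ hθ₀
  simp only [E₂, if_pos rfl, holds_iff] at h₂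
  rw [contains_iff]
  exact ⟨h₁.1, h₂.2⟩

end cover

/-! ## §5 The mistake to avoid: «keep the tighter» across cells -/

/-- TWO CELLS, the INTERSECTION pair is UNSOUND. Points `Bool`; cell 1 = {true} with pair [−1, −1/2], cell 2 = {false}
with pair [−9/10, −2/5]; energy −1 on cell 1 and −2/5 on cell 2 satisfies both cell words, yet the «tighter» pair
[−9/10, −1/2] fails at the point of cell 1. (The sound box pair is the hull [−1, −2/5].) [folklore] -/
theorem tighter_pair_unsound :
    let win : Bool → Win ℚ := fun b => if b then ⟨-1, -1/2⟩ else ⟨-9/10, -2/5⟩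
    let E : Bool → ℚ := fun b => if b then -1 else -2/5
    (∀ θ : Bool, ∃ j : Bool, j = θ ∧ (win j).holds (E θ) = true) ∧
      (Win.mk (-9/10 : ℚ) (-1/2)).holds (E true) = false ∧
      (hull (win true) (win false)).holds (E true) = true ∧ (hull (win true) (win false)).holds (E false) = true := by
  refine ⟨?_, ?_, ?_, ?_⟩
  · intro θ
    refine ⟨θ, rfl, ?_⟩
    cases θ <;> simp [holds] <;> norm_num
  · simp [holds]; norm_num
  · simp [holds, hull]; norm_num
  · simp [holds, hull]; norm_num

/-- CONTRAST (why C5 is still right where it applies): two pairs that BOTH hold for the same value may be intersected —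
«keep the tighter» is sound for two statements about ONE set / one value, not for two cells. [folklore] -/
theorem holds_inter_of_holds (v w : Win β) (e : β) (hv : v.holds e = true) (hw : w.holds e = true) :
    (Win.mk (max v.lo w.lo) (min v.hi w.hi)).holds e = true := by
  rw [holds_iff] at hv hw ⊢
  exact ⟨max_le hv.1 hw.1, le_min hv.2 hw.2⟩

/-! ## §6 Numbers of record (run #5, maps run-2026-08-26e, M15 La₁.₈₇₅Sr₀.₁₂₅CuO₄ object E; hubbard-box-p2 hand-in) -/

/-- M15 cell A, U ∈ [7.9, 9]: [−0.9561961717, −0.5228507720] t_eff. [folklore] -/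
def m15A : Win ℚ := ⟨-9561961717 / 10000000000, -5228507720 / 10000000000⟩
/-- M15 cell B, U ∈ [9, 10]: [−0.9308975186, −0.4331426257]. [folklore] -/
def m15B : Win ℚ := ⟨-9308975186 / 10000000000, -4331426257 / 10000000000⟩
/-- M15 cell C, U ∈ [10, 12]: [−0.9308975186, −0.3097066715]. [folklore] -/
def m15C : Win ℚ := ⟨-9308975186 / 10000000000, -3097066715 / 10000000000⟩
/-- M15 cell D, U ∈ [12, 14.7]: [−0.9308975186, −0.2384112109]. [folklore] -/
def m15D : Win ℚ := ⟨-9308975186 / 10000000000, -2384112109 / 10000000000⟩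
/-- The printed box-level pair of the M15 annex: [−0.9561961717, −0.2384112109]. [folklore] -/
def m15Box : Win ℚ := ⟨-9561961717 / 10000000000, -2384112109 / 10000000000⟩

/-- The printed M15 box pair IS the hull of the four cell pairs (floor from cell A, ceiling from cell D). [folklore] -/
theorem m15Box_eq_hullAll : hullAll m15A [m15B, m15C, m15D] = m15Box := by
  simp only [hullAll, hull, m15A, m15B, m15C, m15D, m15Box, Win.mk.injEq]
  constructor <;> norm_num

/-- … hence it passes the outward check against every cell pair. [folklore] -/
theorem m15Box_contains_cells :
    m15Box.contains m15A = true ∧ m15Box.contains m15B = true ∧ m15Box.contains m15C = true ∧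
      m15Box.contains m15D = true := by
  refine ⟨?_, ?_, ?_, ?_⟩ <;> simp [contains, m15A, m15B, m15C, m15D, m15Box] <;> norm_num

/-- The intersection of the four M15 cell pairs, [−0.9308975186, −0.5228507720], is a DIFFERENT, tighter pair — by §5 not
licensed on the box (it would deny cell A its floor and cell D its ceiling). [folklore] -/
theorem m15_intersection_ne_box :
    (Win.mk (max m15A.lo m15D.lo) (min m15A.hi m15D.hi)) ≠ m15Box := by
  simp only [m15A, m15D, m15Box, ne_eq, Win.mk.injEq, not_and_or]
  left; norm_num

/-- Width of the M15 box pair: 0.7177849608 t_eff (the informativeness figure a census would print). [folklore] -/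
theorem m15Box_width : m15Box.width = 7177849608 / 10000000000 := by
  norm_num [width, m15Box]

/-- The printed M14/M16/M17 box pairs of run #5 ([−0.9716, −0.2537], [−1.0328, −0.2314], [−1.2219, −0.2119] t_eff, 4 dp as
relayed by the assembler) and M15's are well-formed. [folklore] -/
theorem run5_box_pairs_wf :
    (Win.mk (-9716 / 10000 : ℚ) (-2537 / 10000)).wf = true ∧
      (Win.mk (-10328 / 10000 : ℚ) (-2314 / 10000)).wf = true ∧
      (Win.mk (-12219 / 10000 : ℚ) (-2119 / 10000)).wf = true ∧ m15Box.wf = true := by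
  refine ⟨?_, ?_, ?_, ?_⟩ <;> simp [wf, m15Box] <;> norm_num

end Win

end CellScore

end Summit.Ventures.CertifiedManyBodySolver.Downfold
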